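import Literature.NumberTheory.Sieve.GreenTao2008SharpGYDiagonal
import Literature.NumberTheory.Sieve.GoldstonGrahamPintzYildirimLemma3
import Literature.NumberTheory.Sieve.MaynardSieveYm
import Literature.NumberTheory.LFunctions.MoebiusHarmonicSumBound
import Literature.NumberTheory.LFunctions.AFEHarmonicSums
import HarnessLib

/-!
# The sharp Goldston–Yıldırım sums: uniform two-level evaluation of `S₁(q; R₁, R₂)`

Trunk T-SIEVE. A complement to `GreenTao2008SharpGYMoebius` / `GreenTao2008SharpGYDiagonal`
(B. Green, T. Tao, Ann. of Math. 167 (2008), §10), written for the proof of **Proposition 9.6**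
(`Literature.NumberTheory.Sieve.GreenTao2008.GoldstonYildirimCorrelations`): there the local expansion
of the `m`-fold shift correlation produces the one-form sums `S₁(q; R₁, R₂) = SharpGY.diagSum q R₁ R₂`
with a GENERAL sifting modulus `q = W · ∏_{p ∈ S} p` and TWO levels `R₁ = R/n ≤ R₂ = R/n'`, and one
needs their size uniformly in `q` and in the levels. Everything here is PROVED (theorems only):

* `exists_diagSum_bound` — **the evaluation**: for an absolute constant `K`, every `q ≥ 1`
  divisible by all primes `p ≤ w` (`w ≥ 1`) and all `1 ≤ R₁ ≤ R₂`, with `P = q/φ(q)`,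
  `|S₁(q; R₁, R₂) - P log R₁| ≤ P (K (1 + ∑_{p∣q} log p/p + Π_q(1/2)) + 4 P (1 + log R₁)/w)`
  (`Π_q(1/2) = SharpGY.rankinProd (1/2) q`). For `q = W`, `R₁ = R₂ = R` this is
  `S₁(W; R, R) = (1 + O((log w)/w + e^{O(w)}/log R)) (W/φ(W)) log R`, the sharp-cutoff analogue of
  `G(0,0) I = (W/φ(W))(log R + O(1))` (Lemmas 10.3, A.3 of the source), with the uniformity in `w`
  that "`w(N)` sufficiently slowly growing" asks for.

Ingredients, on top of the diagonalisation `SharpGY.diagSum_eq`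
(`S₁ = ∑_{(e,q)=1} μ²(e) φ(e)/e² M_{qe}(R₁/e) M_{qe}(R₂/e)`) and the friable expansion
`SharpGY.moebLogCop_eq_sum` (`M_Q(y) = H_Q(y) + E_Q(y)`, `H_Q(y) = ∑_{k ≤ y, rad k ∣ Q} 1/k`,
`|E_Q(y)| ≤ ∑_k (1/k) C e^{-c√log(y/k)}`):

* `sum_div_mul_antitone_le` — the block estimate `∑_{n ≤ y} (1/n) δ(y/n) ≤ 3 ∑_{k ≤ log y} δ(e^k)`
  for antitone `δ ≥ 0`, and `sum_inv_mul_friableErr_le` — the error sums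
  `∑_{e} (1/e) Ẽ_{qe}(R_i/e)` are sub-sums of it, by the injection `(e, k) ↦ ek`
  (the primes of `e` are the primes of `ek` outside `q`);
* `sum_inv_mul_excess_le` — `∑_{e ≤ z, p ∣ e ⇒ p > w} (1/e)(e/φ(e) - 1) ≤ 2(1 + log z)/w`, which with
  the monotonicity `H_{qe} ≥ H_q` and the Rankin tail `q/φ(q) - H_q(v) ≤ 2 v^{-1/2} Π_q(1/2)`
  (`SharpGY.div_totient_le_sum_radInd_add`) pins the main part without any uniform-in-modulus
  asymptotics for `M_{qe}`;
* `exists_abs_invTotSum_sub_le` — `∑_{e ≤ y, (e,q)=1} μ²(e)/φ(e) = (φ(q)/q)(log y + O(1 + ∑_{p∣q} log p/p))`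
  uniformly, from Goldston–Graham–Pintz–Yıldırım's Lemma 3 (`GGPY.moebiusSqGSum_asymptotic_holds`,
  with Maynard's `γ = 1_{p ∤ q}` of `MaynardSieveYm`).

## References

* B. Green, T. Tao, Ann. of Math. 167 (2008), Prop. 9.6, §10, Lemma 10.3, App. A Lemma A.3.
  [cite: GreenTaoAnnals2008]
* D. A. Goldston, S. W. Graham, J. Pintz, C. Y. Yıldırım, Proc. LMS 98 (2009), Lemma 3.
  [cite: GoldstonEtAl2008]
-/

noncomputable section

open Real Set Filter Topology Finset
open scoped ArithmeticFunction.Moebius ArithmeticFunction.omega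

namespace Literature.NumberTheory.Sieve.GreenTao2008

namespace GYCorr

open SharpGY

/-! ### The block estimate `∑_{n ≤ y} (1/n) δ(y/n) ≤ 3 ∑_{k ≤ log y} δ(e^k)` -/

/-- The harmonic sum over one `e`-adic block `(a, ea]` is at most `3`. [folklore] -/
theorem sum_inv_block_le_three {a : ℝ} (ha : 0 < a) {s : Finset ℕ}
    (hs : ∀ n ∈ s, 1 ≤ n ∧ a < n ∧ (n : ℝ) ≤ Real.exp 1 * a) :
    ∑ n ∈ s, (1 : ℝ) / n ≤ 3 := by
  have he : Real.exp 1 < 3 := by have := Real.exp_one_lt_d9; linarith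
  rcases lt_or_ge a 1 with ha1 | ha1
  · -- `s ⊆ {1, 2}`
    have hsub : s ⊆ Finset.Icc 1 2 := by
      intro n hn
      obtain ⟨h1, -, h3⟩ := hs n hn
      rw [Finset.mem_Icc]
      refine ⟨h1, ?_⟩
      have : (n : ℝ) < 3 := by nlinarith
      exact_mod_cast Nat.lt_succ_iff.1 (by exact_mod_cast this : n < 3)
    calc ∑ n ∈ s, (1 : ℝ) / n ≤ ∑ n ∈ Finset.Icc (1 : ℕ) 2, (1 : ℝ) / (n : ℝ) :=
          sum_le_sum_of_subset_of_nonneg hsub fun n _ _ => by positivity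
      _ ≤ 3 := by
          rw [show Finset.Icc (1 : ℕ) 2 = {1, 2} from rfl, Finset.sum_insert (by simp), Finset.sum_singleton]
          norm_num
  · -- `#s ≤ (e - 1) a + 1` terms, each `≤ 1/a`
    have hsub : s ⊆ Finset.Ioc ⌊a⌋₊ ⌊Real.exp 1 * a⌋₊ := by
      intro n hn
      obtain ⟨-, h2, h3⟩ := hs n hn
      rw [Finset.mem_Ioc]
      exact ⟨(Nat.floor_lt ha.le).2 h2, Nat.le_floor h3⟩
    have hcard : (s.card : ℝ) ≤ (Real.exp 1 - 1) * a + 1 := by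
      have h1 : s.card ≤ ⌊Real.exp 1 * a⌋₊ - ⌊a⌋₊ := by
        have := Finset.card_le_card hsub; rwa [Nat.card_Ioc] at this
      have hle : ⌊a⌋₊ ≤ ⌊Real.exp 1 * a⌋₊ := Nat.floor_le_floor (by nlinarith [Real.add_one_le_exp (1 : ℝ)])
      have h2 : ((⌊Real.exp 1 * a⌋₊ - ⌊a⌋₊ : ℕ) : ℝ) = ⌊Real.exp 1 * a⌋₊ - ⌊a⌋₊ := Nat.cast_sub hle
      have h3 : (⌊Real.exp 1 * a⌋₊ : ℝ) ≤ Real.exp 1 * a := Nat.floor_le (by positivity)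
      have h4 : a - 1 < ⌊a⌋₊ := by have := Nat.lt_floor_add_one a; linarith
      calc (s.card : ℝ) ≤ ((⌊Real.exp 1 * a⌋₊ - ⌊a⌋₊ : ℕ) : ℝ) := by exact_mod_cast h1
        _ = ⌊Real.exp 1 * a⌋₊ - ⌊a⌋₊ := h2
        _ ≤ (Real.exp 1 - 1) * a + 1 := by linarith
    have hterm : ∀ n ∈ s, (1 : ℝ) / n ≤ 1 / a := fun n hn =>
      one_div_le_one_div_of_le ha (hs n hn).2.1.le
    calc ∑ n ∈ s, (1 : ℝ) / n ≤ ∑ n ∈ s, 1 / a := sum_le_sum hterm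
      _ = s.card * (1 / a) := by rw [sum_const, nsmul_eq_mul]
      _ ≤ ((Real.exp 1 - 1) * a + 1) * (1 / a) := mul_le_mul_of_nonneg_right hcard (by positivity)
      _ = (Real.exp 1 - 1) + 1 / a := by field_simp
      _ ≤ 3 := by
          have : 1 / a ≤ 1 := by rw [div_le_one ha]; exact ha1
          linarith

/-- **The block estimate**: for `δ ≥ 0` antitone on `[1, ∞)` and `y ≥ 1`,
`∑_{n ≤ y} (1/n) δ(y/n) ≤ 3 ∑_{0 ≤ k ≤ log y} δ(e^k)` (group `n` according to
`k = ⌊log(y/n)⌋`, i.e. `n ∈ (y e^{-k-1}, y e^{-k}]`, where `δ(y/n) ≤ δ(e^k)` and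
`∑ 1/n ≤ 3`). [folklore] -/
theorem sum_div_mul_antitone_le {δ : ℝ → ℝ} (hδ0 : ∀ u : ℝ, 1 ≤ u → 0 ≤ δ u)
    (hδ : AntitoneOn δ (Set.Ici 1)) {y : ℝ} (hy : 1 ≤ y) :
    ∑ n ∈ Finset.Icc 1 ⌊y⌋₊, 1 / (n : ℝ) * δ (y / n) ≤
      3 * ∑ k ∈ Finset.range (⌊Real.log y⌋₊ + 1), δ (Real.exp k) := by
  have hy0 : 0 < y := by linarith
  set g : ℕ → ℕ := fun n => ⌊Real.log (y / n)⌋₊ with hg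
  have hmaps : ∀ n ∈ Finset.Icc 1 ⌊y⌋₊, g n ∈ Finset.range (⌊Real.log y⌋₊ + 1) := by
    intro n hn
    rw [Finset.mem_range, Nat.lt_succ_iff, hg]
    refine Nat.floor_le_floor (Real.log_le_log (div_pos hy0 (by exact_mod_cast (Finset.mem_Icc.1 hn).1)) ?_)
    exact div_le_self hy0.le (by exact_mod_cast (Finset.mem_Icc.1 hn).1)
  rw [← sum_fiberwise_of_maps_to hmaps, mul_sum]
  refine sum_le_sum fun k _ => ?_
  have hfib : ∀ n ∈ (Finset.Icc 1 ⌊y⌋₊).filter (fun n => g n = k),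
      1 ≤ n ∧ Real.exp k ≤ y / n ∧ y / n < Real.exp (k + 1) := by
    intro n hn
    rw [Finset.mem_filter, Finset.mem_Icc] at hn
    have hn0 : (0 : ℝ) < n := by exact_mod_cast hn.1.1
    have hyn : 1 ≤ y / n := by
      rw [le_div_iff₀ hn0, one_mul]
      exact le_trans (by exact_mod_cast hn.1.2) (Nat.floor_le hy0.le)
    have hlog0 : 0 ≤ Real.log (y / n) := Real.log_nonneg hyn
    have hk := (Nat.floor_eq_iff hlog0).1 hn.2
    refine ⟨hn.1.1, ?_, ?_⟩
    · calc Real.exp k ≤ Real.exp (Real.log (y / n)) := Real.exp_le_exp.2 hk.1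
        _ = y / n := Real.exp_log (by positivity)
    · calc y / n = Real.exp (Real.log (y / n)) := (Real.exp_log (by positivity)).symm
        _ < Real.exp (k + 1) := Real.exp_lt_exp.2 hk.2
  have hek : 1 ≤ Real.exp (k : ℝ) := Real.one_le_exp (Nat.cast_nonneg k)
  calc ∑ n ∈ (Finset.Icc 1 ⌊y⌋₊).filter (fun n => g n = k), 1 / (n : ℝ) * δ (y / n)
      ≤ ∑ n ∈ (Finset.Icc 1 ⌊y⌋₊).filter (fun n => g n = k), 1 / (n : ℝ) * δ (Real.exp k) := by
        refine sum_le_sum fun n hn => ?_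
        obtain ⟨-, h2, -⟩ := hfib n hn
        exact mul_le_mul_of_nonneg_left (hδ hek (le_trans hek h2) h2) (by positivity)
    _ = (∑ n ∈ (Finset.Icc 1 ⌊y⌋₊).filter (fun n => g n = k), 1 / (n : ℝ)) * δ (Real.exp k) := by
        rw [sum_mul]
    _ ≤ 3 * δ (Real.exp k) := by
        refine mul_le_mul_of_nonneg_right ?_ (hδ0 _ hek)
        refine sum_inv_block_le_three (a := y / Real.exp (k + 1)) (by positivity) fun n hn => ?_
        obtain ⟨h1, h2, h3⟩ := hfib n hn
        have hn0 : (0 : ℝ) < n := by exact_mod_cast h1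
        refine ⟨h1, ?_, ?_⟩
        · rw [div_lt_iff₀ (Real.exp_pos _)]
          rw [div_lt_iff₀ hn0] at h3
          linarith [mul_comm (n : ℝ) (Real.exp (k + 1))]
        · rw [le_div_iff₀ hn0] at h2
          have : Real.exp 1 * (y / Real.exp ((k : ℝ) + 1)) = y / Real.exp k := by
            rw [Real.exp_add]
            field_simp
          rw [this, le_div_iff₀ (Real.exp_pos _)]
          linarith [mul_comm (n : ℝ) (Real.exp k)]

/-! ### The decay function `δ₁(u) = C e^{-c√log u}` -/

/-- `δ₁(u) = C exp(-c√log u)` is nonnegative and antitone on `[1, ∞)` (`c, C ≥ 0`). [folklore] -/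
theorem antitoneOn_expDecay {c C : ℝ} (hc : 0 ≤ c) (hC : 0 ≤ C) :
    (∀ u : ℝ, 1 ≤ u → 0 ≤ C * Real.exp (-(c * Real.sqrt (Real.log u)))) ∧
      AntitoneOn (fun u : ℝ => C * Real.exp (-(c * Real.sqrt (Real.log u)))) (Set.Ici 1) := by
  refine ⟨fun u _ => by positivity, fun u hu v _ huv => ?_⟩
  have hu1 : (1 : ℝ) ≤ u := hu
  refine mul_le_mul_of_nonneg_left (Real.exp_le_exp.2 (neg_le_neg (mul_le_mul_of_nonneg_left ?_ hc))) hC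
  exact Real.sqrt_le_sqrt (Real.log_le_log (by linarith) huv)

/-- `∑_{0 ≤ k ≤ L} C exp(-c√k) ≤ C (1 + 48/c⁴)` (`exp(-c√k) ≤ 24/(c⁴k²)` and `∑ 1/k² ≤ 2`).
[folklore] -/
theorem sum_expDecay_exp_le {c C : ℝ} (hc : 0 < c) (hC : 0 ≤ C) (L : ℕ) :
    ∑ k ∈ Finset.range (L + 1), C * Real.exp (-(c * Real.sqrt (Real.log (Real.exp k)))) ≤
      C * (1 + 48 / c ^ 4) := by
  rw [← Finset.mul_sum]
  refine mul_le_mul_of_nonneg_left ?_ hC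
  rw [Finset.sum_range_succ', Nat.cast_zero, Real.exp_zero, Real.log_one, Real.sqrt_zero, mul_zero, neg_zero,
    Real.exp_zero, add_comm]
  refine add_le_add le_rfl ?_
  have hterm : ∀ k ∈ Finset.range L, Real.exp (-(c * Real.sqrt (Real.log (Real.exp ((k + 1 : ℕ) : ℝ))))) ≤
      24 / c ^ 4 * ((((k + 1 : ℕ) : ℝ)) ^ 2)⁻¹ := by
    intro k _
    rw [Real.log_exp]
    have hk : (0 : ℝ) < ((k + 1 : ℕ) : ℝ) := by positivity
    have h := LFunctions.MoebiusSum.exp_neg_mul_sqrt_le hc hk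
    refine h.trans (le_of_eq ?_)
    rw [← div_div, div_eq_mul_inv]
  calc ∑ k ∈ Finset.range L, Real.exp (-(c * Real.sqrt (Real.log (Real.exp ((k + 1 : ℕ) : ℝ)))))
      ≤ ∑ k ∈ Finset.range L, 24 / c ^ 4 * ((((k + 1 : ℕ) : ℝ)) ^ 2)⁻¹ := Finset.sum_le_sum hterm
    _ = 24 / c ^ 4 * ∑ k ∈ Finset.range L, ((((k + 1 : ℕ) : ℝ)) ^ 2)⁻¹ := by rw [Finset.mul_sum]
    _ ≤ 24 / c ^ 4 * 2 := by
        refine mul_le_mul_of_nonneg_left ?_ (by positivity)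
        have h := sum_Ioo_inv_sq_le (α := ℝ) 0 (L + 1)
        rw [Nat.cast_zero, zero_add, div_one] at h
        refine le_trans (le_of_eq ?_) h
        rw [show Finset.Ioo 0 (L + 1) = Finset.Ico 1 (L + 1) from rfl, Finset.sum_Ico_eq_sum_range]
        simp only [Nat.add_sub_cancel]
        refine Finset.sum_congr rfl fun k _ => ?_
        push_cast
        ring
    _ = 48 / c ^ 4 := by ring

/-! ### `M(y) = 1 + O(e^{-c√log y})` for all `y ≥ 1`, and the friable error sums `Ẽ_Q` -/

/-- `|M(y) - 1| ≤ C exp(-c√log y)` for ALL `y ≥ 1` (the threshold version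
`SharpGY.exists_abs_moebLog_sub_one_le` combined with the uniform bound `SharpGY.exists_moebLog_bound`).
[cite: GreenTaoAnnals2008, Appendix A Lemma A.3] -/
theorem exists_abs_moebLog_sub_one_le_all :
    ∃ c : ℝ, 0 < c ∧ ∃ C : ℝ, 0 ≤ C ∧ ∀ y : ℝ, 1 ≤ y →
      |moebLog y - 1| ≤ C * Real.exp (-(c * Real.sqrt (Real.log y))) := by
  obtain ⟨c, hc, R₀, hR₀, h⟩ := exists_abs_moebLog_sub_one_le
  obtain ⟨B, hB1, hB⟩ := exists_moebLog_bound
  set E₀ := Real.exp (-(c * Real.sqrt (Real.log R₀))) with hE₀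
  have hE₀0 : 0 < E₀ := Real.exp_pos _
  refine ⟨c, hc, max 1 ((B + 1) / E₀), le_max_of_le_left zero_le_one, fun y hy => ?_⟩
  rcases le_or_gt R₀ y with hRy | hRy
  · calc |moebLog y - 1| ≤ Real.exp (-(c * Real.sqrt (Real.log y))) := h y hRy
      _ = 1 * Real.exp (-(c * Real.sqrt (Real.log y))) := (one_mul _).symm
      _ ≤ max 1 ((B + 1) / E₀) * Real.exp (-(c * Real.sqrt (Real.log y))) :=
          mul_le_mul_of_nonneg_right (le_max_left _ _) (Real.exp_pos _).le
  · have h1 : |moebLog y - 1| ≤ B + 1 := by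
      calc |moebLog y - 1| ≤ |moebLog y| + |(1 : ℝ)| := abs_sub _ _
        _ ≤ B + 1 := by rw [abs_one]; exact add_le_add (hB y) le_rfl
    have h2 : E₀ ≤ Real.exp (-(c * Real.sqrt (Real.log y))) := by
      rw [hE₀]
      refine Real.exp_le_exp.2 (neg_le_neg (mul_le_mul_of_nonneg_left ?_ hc.le))
      exact Real.sqrt_le_sqrt (Real.log_le_log (by linarith) hRy.le)
    calc |moebLog y - 1| ≤ B + 1 := h1
      _ = (B + 1) / E₀ * E₀ := by field_simp
      _ ≤ max 1 ((B + 1) / E₀) * Real.exp (-(c * Real.sqrt (Real.log y))) :=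
          mul_le_mul (le_max_right _ _) h2 hE₀0.le (le_trans zero_le_one (le_max_left _ _))

/-- **`|M_Q(y) - H_Q(y)| ≤ Ẽ_Q(y) := ∑_{k ≤ y, rad k ∣ Q} (1/k) · C exp(-c√log(y/k))`**, where
`H_Q(y) = ∑_{k ≤ y, rad k ∣ Q} 1/k`: the friable expansion `SharpGY.moebLogCop_eq_sum` with
`M = 1 + O(e^{-c√log})` inserted. [folklore] -/
theorem abs_moebLogCop_sub_sum_le {c C : ℝ}
    (hg : ∀ y : ℝ, 1 ≤ y → |moebLog y - 1| ≤ C * Real.exp (-(c * Real.sqrt (Real.log y))))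
    {Q : ℕ} (hQ : Q ≠ 0) (y : ℝ) :
    |moebLogCop Q y - ∑ k ∈ (Finset.Icc 1 ⌊y⌋₊).filter (fun k : ℕ => k.primeFactors ⊆ Q.primeFactors), (1 : ℝ) / k| ≤
      ∑ k ∈ (Finset.Icc 1 ⌊y⌋₊).filter (fun k : ℕ => k.primeFactors ⊆ Q.primeFactors),
        1 / (k : ℝ) * (C * Real.exp (-(c * Real.sqrt (Real.log (y / k))))) := by
  rw [moebLogCop_eq_sum hQ, ← sum_sub_distrib]
  refine (abs_sum_le_sum_abs _ _).trans (sum_le_sum fun k hk => ?_)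
  rw [Finset.mem_filter, Finset.mem_Icc] at hk
  have hk0 : (0 : ℝ) < k := by exact_mod_cast hk.1.1
  have hyk : 1 ≤ y / k := by
    rw [le_div_iff₀ hk0, one_mul]
    have h1 : (k : ℝ) ≤ ⌊y⌋₊ := by exact_mod_cast hk.1.2
    have hy0 : 0 ≤ y := by
      by_contra hneg
      push Not at hneg
      have : ⌊y⌋₊ = 0 := Nat.floor_of_nonpos hneg.le
      omega
    exact h1.trans (Nat.floor_le hy0)
  have heq : moebLog (y / k) / k - 1 / k = 1 / (k : ℝ) * (moebLog (y / k) - 1) := by ring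
  rw [heq, abs_mul, abs_of_pos (by positivity : (0 : ℝ) < 1 / k)]
  exact mul_le_mul_of_nonneg_left (hg _ hyk) (by positivity)

/-! ### The friable harmonic sums `H_Q(v) = ∑_{k ≤ v, rad k ∣ Q} 1/k` -/

/-- `H_Q(v) ≥ 0`. [folklore] -/
theorem friable_nonneg (Q : ℕ) (v : ℝ) :
    0 ≤ ∑ k ∈ (Finset.Icc 1 ⌊v⌋₊).filter (fun k : ℕ => k.primeFactors ⊆ Q.primeFactors), (1 : ℝ) / k :=
  sum_nonneg fun k _ => by positivity

/-- `H_Q` is monotone in `v`. [folklore] -/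
theorem friable_mono (Q : ℕ) {v v' : ℝ} (h : v ≤ v') :
    ∑ k ∈ (Finset.Icc 1 ⌊v⌋₊).filter (fun k : ℕ => k.primeFactors ⊆ Q.primeFactors), (1 : ℝ) / k ≤
      ∑ k ∈ (Finset.Icc 1 ⌊v'⌋₊).filter (fun k : ℕ => k.primeFactors ⊆ Q.primeFactors), (1 : ℝ) / k := by
  refine sum_le_sum_of_subset_of_nonneg (fun k hk => ?_) fun k _ _ => by positivity
  rw [Finset.mem_filter, Finset.mem_Icc] at hk ⊢
  exact ⟨⟨hk.1.1, hk.1.2.trans (Nat.floor_le_floor h)⟩, hk.2⟩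

/-- `H_Q ≤ H_{Q'}` when the primes of `Q` are primes of `Q'`. [folklore] -/
theorem friable_mono_left {Q Q' : ℕ} (h : Q.primeFactors ⊆ Q'.primeFactors) (v : ℝ) :
    ∑ k ∈ (Finset.Icc 1 ⌊v⌋₊).filter (fun k : ℕ => k.primeFactors ⊆ Q.primeFactors), (1 : ℝ) / k ≤
      ∑ k ∈ (Finset.Icc 1 ⌊v⌋₊).filter (fun k : ℕ => k.primeFactors ⊆ Q'.primeFactors), (1 : ℝ) / k := by
  refine sum_le_sum_of_subset_of_nonneg (fun k hk => ?_) fun k _ _ => by positivity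
  rw [Finset.mem_filter] at hk ⊢
  exact ⟨hk.1, hk.2.trans h⟩

/-- `⌊v⌋^{-1/2} ≤ 2 v^{-1/2}` for `v ≥ 1`. [folklore] -/
theorem floor_rpow_neg_half_le {v : ℝ} (hv : 1 ≤ v) :
    ((⌊v⌋₊ : ℕ) : ℝ) ^ (-(1 / 2 : ℝ)) ≤ 2 * v ^ (-(1 / 2 : ℝ)) := by
  have hv0 : 0 < v := by linarith
  have hfl : v / 4 ≤ ⌊v⌋₊ := by
    have h1 : (1 : ℝ) ≤ ⌊v⌋₊ := by exact_mod_cast Nat.le_floor (by simpa using hv)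
    have h2 : v < ⌊v⌋₊ + 1 := Nat.lt_floor_add_one v
    linarith
  have h3 : ((⌊v⌋₊ : ℕ) : ℝ) ^ (-(1 / 2 : ℝ)) ≤ (v / 4) ^ (-(1 / 2 : ℝ)) :=
    Real.rpow_le_rpow_of_nonpos (by positivity) hfl (by norm_num)
  refine h3.trans (le_of_eq ?_)
  rw [Real.div_rpow hv0.le (by norm_num), show (4 : ℝ) = 2 ^ (2 : ℝ) by norm_num, ← Real.rpow_mul (by norm_num)]
  norm_num
  ring

/-- **The Rankin tail with a real cut-off**: for `Q ≥ 1` and `v ≥ 1`,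
`Q/φ(Q) - H_Q(v) ≤ 2 v^{-1/2} Π_Q(1/2)` (`SharpGY.div_totient_le_sum_radInd_add` at `N = ⌊v⌋`).
[folklore] -/
theorem div_totient_sub_friable_le {Q : ℕ} (hQ : Q ≠ 0) {v : ℝ} (hv : 1 ≤ v) :
    (Q : ℝ) / Q.totient - ∑ k ∈ (Finset.Icc 1 ⌊v⌋₊).filter (fun k : ℕ => k.primeFactors ⊆ Q.primeFactors), (1 : ℝ) / k ≤
      2 * v ^ (-(1 / 2 : ℝ)) * rankinProd (1 / 2) Q := by
  have hN : 1 ≤ ⌊v⌋₊ := Nat.le_floor (by simpa using hv)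
  have h := div_totient_le_sum_radInd_add hQ hN
  have hPq : 0 ≤ rankinProd (1 / 2) Q := le_trans zero_le_one (one_le_rankinProd (by norm_num) Q)
  have h2 := mul_le_mul_of_nonneg_right (floor_rpow_neg_half_le hv) hPq
  linarith

/-- `r/φ(r) = ∏_{p ∣ r} (1 - 1/p)⁻¹` (`r ≥ 1`). [folklore] -/
theorem div_totient_eq_prod_inv {r : ℕ} (hr : r ≠ 0) :
    (r : ℝ) / r.totient = ∏ p ∈ r.primeFactors, (1 - (p : ℝ)⁻¹)⁻¹ := by
  rw [div_totient_eq_rankinProd hr]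
  unfold rankinProd
  refine Finset.prod_congr rfl fun p _ => ?_
  rw [Real.rpow_neg (Nat.cast_nonneg _), Real.rpow_one]

/-! ### The error sums: the injection `(r, t) ↦ rt` -/

/-- For `r` coprime to `q` and `t` an `rq`-friable number, the prime factors of `r` are those of
`rt` outside `q`. [folklore] -/
theorem primeFactors_eq_sdiff {r t q : ℕ} (hr : r ≠ 0) (ht : t ≠ 0) (hq : q ≠ 0) (hcop : r.Coprime q)
    (hsub : t.primeFactors ⊆ (q * r).primeFactors) :
    r.primeFactors = (r * t).primeFactors \ q.primeFactors := by
  ext p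
  rw [Finset.mem_sdiff, Nat.primeFactors_mul hr ht, Finset.mem_union]
  constructor
  · intro hp
    refine ⟨Or.inl hp, fun hpq => ?_⟩
    have hpp := Nat.prime_of_mem_primeFactors hp
    have h1 : ¬p ∣ q := (Nat.Prime.coprime_iff_not_dvd hpp).1
      (hcop.coprime_dvd_left (Nat.dvd_of_mem_primeFactors hp))
    exact h1 (Nat.dvd_of_mem_primeFactors hpq)
  · rintro ⟨h | h, hpq⟩
    · exact h
    · have := hsub h
      rw [Nat.primeFactors_mul hq hr, Finset.mem_union] at this
      exact this.resolve_left hpq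

/-- **The error sums are bounded by the block estimate**: for `δ ≥ 0` antitone on `[1, ∞)`,
`∑_{r ≤ y, r squarefree, (r,q)=1} (1/r) ∑_{t ≤ y/r, t (rq)-friable} (1/t) δ(y/(rt)) ≤ 3 ∑_{k ≤ log y} δ(e^k)`:
the map `(r, t) ↦ rt` is injective (the primes of `r` are the primes of `rt` outside `q`), so the
left side is a sub-sum of `∑_{n ≤ y} (1/n) δ(y/n)`. [folklore] -/
theorem sum_inv_mul_friableErr_le {δ : ℝ → ℝ} (hδ0 : ∀ u : ℝ, 1 ≤ u → 0 ≤ δ u)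
    (hδ : AntitoneOn δ (Set.Ici 1)) {q : ℕ} (hq : q ≠ 0) {y : ℝ} (hy : 1 ≤ y) :
    ∑ r ∈ (Finset.Icc 1 ⌊y⌋₊).filter (fun r => Squarefree r ∧ r.Coprime q),
      1 / (r : ℝ) * ∑ t ∈ (Finset.Icc 1 ⌊y / r⌋₊).filter (fun t : ℕ => t.primeFactors ⊆ (q * r).primeFactors),
        1 / (t : ℝ) * δ (y / r / t) ≤
      3 * ∑ k ∈ Finset.range (⌊Real.log y⌋₊ + 1), δ (Real.exp k) := by
  have hy0 : 0 < y := by linarith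
  set S := (Finset.Icc 1 ⌊y⌋₊).filter (fun r => Squarefree r ∧ r.Coprime q) with hS
  set T : ℕ → Finset ℕ := fun r =>
    (Finset.Icc 1 ⌊y / r⌋₊).filter (fun t : ℕ => t.primeFactors ⊆ (q * r).primeFactors) with hT
  set g : ℕ → ℝ := fun n => 1 / (n : ℝ) * δ (y / n) with hg
  -- rewrite as a sum over the sigma type, with summand `g (r t)`
  have h1 : ∑ r ∈ S, 1 / (r : ℝ) * ∑ t ∈ T r, 1 / (t : ℝ) * δ (y / r / t) =
      ∑ x ∈ S.sigma T, g (x.1 * x.2) := by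
    rw [Finset.sum_sigma]
    refine Finset.sum_congr rfl fun r hr => ?_
    rw [Finset.mul_sum]
    refine Finset.sum_congr rfl fun t ht => ?_
    have hr0 : (0 : ℝ) < r := by exact_mod_cast (Finset.mem_Icc.1 (Finset.mem_filter.1 hr).1).1
    have ht0 : (0 : ℝ) < t := by exact_mod_cast (Finset.mem_Icc.1 (Finset.mem_filter.1 ht).1).1
    rw [hg]
    simp only
    push_cast
    rw [div_div, ← mul_assoc, one_div_mul_one_div]
  rw [h1]
  -- injectivity of `(r, t) ↦ rt` on the sigma set
  have hinj : Set.InjOn (fun x : (Σ _ : ℕ, ℕ) => x.1 * x.2) (S.sigma T : Set (Σ _ : ℕ, ℕ)) := by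
    rintro ⟨r, t⟩ hx ⟨r', t'⟩ hx' heq
    simp only [Finset.coe_sigma, Set.mem_sigma_iff, Finset.mem_coe] at hx hx'
    rw [hS, Finset.mem_filter, Finset.mem_Icc] at hx hx'
    rw [hT, Finset.mem_filter, Finset.mem_Icc] at hx hx'
    simp only at heq
    have hr0 : r ≠ 0 := by omega
    have hr0' : r' ≠ 0 := by omega
    have ht0 : t ≠ 0 := by omega
    have ht0' : t' ≠ 0 := by omega
    have hpf : r.primeFactors = r'.primeFactors := by
      rw [primeFactors_eq_sdiff hr0 ht0 hq hx.1.2.2 hx.2.2, primeFactors_eq_sdiff hr0' ht0' hq hx'.1.2.2 hx'.2.2,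
        heq]
    have hrr : r = r' := by
      rw [← Nat.prod_primeFactors_of_squarefree hx.1.2.1, ← Nat.prod_primeFactors_of_squarefree hx'.1.2.1, hpf]
    subst hrr
    have htt : t = t' := Nat.eq_of_mul_eq_mul_left (Nat.pos_of_ne_zero hr0) heq
    subst htt
    rfl
  rw [← Finset.sum_image hinj]
  -- the image lies in `[1, y]`
  have hsub : (S.sigma T).image (fun x : (Σ _ : ℕ, ℕ) => x.1 * x.2) ⊆ Finset.Icc 1 ⌊y⌋₊ := by
    intro n hn
    obtain ⟨⟨r, t⟩, hx, rfl⟩ := Finset.mem_image.1 hn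
    rw [Finset.mem_sigma, hS, Finset.mem_filter, Finset.mem_Icc, hT, Finset.mem_filter, Finset.mem_Icc] at hx
    rw [Finset.mem_Icc]
    refine ⟨Nat.one_le_iff_ne_zero.2 (Nat.mul_ne_zero (by omega) (by omega)), ?_⟩
    have hr0 : (0 : ℝ) < r := by exact_mod_cast hx.1.1.1
    have h2 : (t : ℝ) ≤ y / r := le_trans (by exact_mod_cast hx.2.1.2) (Nat.floor_le (by positivity))
    rw [le_div_iff₀ hr0] at h2
    exact Nat.le_floor (by push_cast; linarith [mul_comm (t : ℝ) r])
  have hnonneg : ∀ n ∈ Finset.Icc 1 ⌊y⌋₊, 0 ≤ g n := by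
    intro n hn
    have hn0 : (0 : ℝ) < n := by exact_mod_cast (Finset.mem_Icc.1 hn).1
    have hyn : 1 ≤ y / n := by
      rw [le_div_iff₀ hn0, one_mul]
      exact le_trans (by exact_mod_cast (Finset.mem_Icc.1 hn).2) (Nat.floor_le hy0.le)
    exact mul_nonneg (by positivity) (hδ0 _ hyn)
  calc ∑ n ∈ (S.sigma T).image (fun x : (Σ _ : ℕ, ℕ) => x.1 * x.2), g n
      ≤ ∑ n ∈ Finset.Icc 1 ⌊y⌋₊, g n := Finset.sum_le_sum_of_subset_of_nonneg hsub fun n hn _ => hnonneg n hn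
    _ ≤ 3 * ∑ k ∈ Finset.range (⌊Real.log y⌋₊ + 1), δ (Real.exp k) := sum_div_mul_antitone_le hδ0 hδ hy

/-! ### The excess `∑_{r} (1/r)(r/φ(r) - 1)` over integers with all prime factors `> w` -/

/-- `∏_{p ∣ r} (1 - 1/p)⁻¹ - 1 = ∑_{∅ ≠ t ⊆ {p ∣ r}} ∏_{p ∈ t} 1/(p-1)` (expand `∏ (1 + 1/(p-1))`).
[folklore] -/
theorem prod_one_sub_inv_inv_sub_one_eq (r : ℕ) :
    ∏ p ∈ r.primeFactors, (1 - (p : ℝ)⁻¹)⁻¹ - 1 =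
      ∑ t ∈ r.primeFactors.powerset.erase ∅, ∏ p ∈ t, 1 / ((p : ℝ) - 1) := by
  have h1 : ∏ p ∈ r.primeFactors, (1 - (p : ℝ)⁻¹)⁻¹ = ∏ p ∈ r.primeFactors, (1 + 1 / ((p : ℝ) - 1)) := by
    refine Finset.prod_congr rfl fun p hp => ?_
    have hp1 : (1 : ℝ) < p := by exact_mod_cast (Nat.prime_of_mem_primeFactors hp).one_lt
    have hp0 : (p : ℝ) - 1 ≠ 0 := by linarith
    have hp0' : (p : ℝ) ≠ 0 := by linarith
    field_simp
    ring
  rw [h1, Finset.prod_one_add, Finset.sum_erase_eq_sub (Finset.empty_mem_powerset _), Finset.prod_empty]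

/-- `∑_{r ≤ N, d ∣ r} 1/r ≤ (1 + log N)/d` for `d, N ≥ 1`. [folklore] -/
theorem sum_inv_filter_dvd_le {d N : ℕ} (hd : 1 ≤ d) (hN : 1 ≤ N) :
    ∑ r ∈ (Finset.Icc 1 N).filter (fun r => d ∣ r), 1 / (r : ℝ) ≤ (1 + Real.log N) / d := by
  rw [GGPY.Lemma3.filter_dvd_Icc_eq_image hd N,
    Finset.sum_image (fun x _ y _ h => Nat.eq_of_mul_eq_mul_left hd h)]
  have hd0 : (0 : ℝ) < d := by exact_mod_cast hd
  have h1 : ∑ m ∈ Finset.Icc 1 (N / d), 1 / ((d * m : ℕ) : ℝ) = (1 / d) * ∑ m ∈ Finset.Icc 1 (N / d), 1 / (m : ℝ) := by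
    rw [Finset.mul_sum]
    refine Finset.sum_congr rfl fun m _ => ?_
    push_cast
    rw [one_div_mul_one_div]
  rw [h1, div_eq_mul_inv (1 + Real.log N) d, mul_comm (1 + Real.log N), one_div]
  refine mul_le_mul_of_nonneg_left ?_ (by positivity)
  have h2 : ∑ m ∈ Finset.Icc 1 (N / d), 1 / (m : ℝ) = (harmonic (N / d) : ℝ) := by
    rw [harmonic_eq_sum_Icc]; push_cast
    exact Finset.sum_congr rfl fun m _ => by simp
  rw [h2]
  refine (harmonic_le_one_add_log (N / d)).trans (add_le_add le_rfl ?_)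
  rcases Nat.eq_zero_or_pos (N / d) with h0 | hpos
  · rw [h0, Nat.cast_zero, Real.log_zero]
    exact Real.log_nonneg (by exact_mod_cast hN)
  · exact Real.log_le_log (by exact_mod_cast hpos) (by exact_mod_cast Nat.div_le_self N d)

/-- Telescoping: `∑_{w < n ≤ N} 1/(n(n-1)) ≤ 1/w` (`w ≥ 1`). [folklore] -/
theorem sum_Ioc_inv_mul_sub_one_le {w : ℕ} (hw : 1 ≤ w) (N : ℕ) :
    ∑ n ∈ Finset.Ioc w N, 1 / ((n : ℝ) * ((n : ℝ) - 1)) ≤ 1 / w := by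
  rcases le_or_gt N w with h | h
  · rw [Finset.Ioc_eq_empty (by omega), Finset.sum_empty]; positivity
  · have key : ∀ M : ℕ, w ≤ M →
        ∑ n ∈ Finset.Ioc w M, 1 / ((n : ℝ) * ((n : ℝ) - 1)) = 1 / w - 1 / M := by
      intro M hM
      induction M, hM using Nat.le_induction with
      | base => simp
      | succ M hM ih =>
        rw [Finset.sum_Ioc_succ_top hM, ih]
        have hM0 : (0 : ℝ) < M := by exact_mod_cast lt_of_lt_of_le hw hM
        have hM1 : ((M + 1 : ℕ) : ℝ) - 1 = M := by push_cast; ring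
        rw [hM1]
        push_cast
        field_simp
        ring
    rw [key N h.le]
    have : (0 : ℝ) ≤ 1 / N := by positivity
    linarith

/-- **The excess lemma**: `∑_{r ≤ z, r squarefree, p ∣ r ⇒ p > w} (1/r)(∏_{p∣r}(1-1/p)⁻¹ - 1) ≤ 2(1 + log z)/w`
(`w ≥ 1`, `z ≥ 1`). Expanding `r/φ(r) - 1 = ∑_{1 < d ∣ r} 1/φ(d)` and summing `r` over the multiples
of `d` first gives `≤ (1 + log z)(∏_{w < p ≤ z} (1 + 1/(p(p-1))) - 1) ≤ (1 + log z)(e^{1/w} - 1)`.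
[folklore] -/
theorem sum_inv_mul_excess_le {w : ℕ} (hw : 1 ≤ w) {z : ℝ} (hz : 1 ≤ z) :
    ∑ r ∈ (Finset.Icc 1 ⌊z⌋₊).filter (fun r => Squarefree r ∧ ∀ p ∈ r.primeFactors, w < p),
      1 / (r : ℝ) * (∏ p ∈ r.primeFactors, (1 - (p : ℝ)⁻¹)⁻¹ - 1) ≤ 2 * (1 + Real.log z) / w := by
  set N := ⌊z⌋₊ with hN
  have hN1 : 1 ≤ N := Nat.le_floor (by simpa using hz)
  have hz0 : 0 < z := by linarith
  set F := (Finset.Icc 1 N).filter (fun r => Squarefree r ∧ ∀ p ∈ r.primeFactors, w < p) with hF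
  set P' := (Finset.Ioc w N).filter Nat.Prime with hP'
  set U := P'.powerset.erase ∅ with hU
  set g : Finset ℕ → ℝ := fun t => ∏ p ∈ t, 1 / ((p : ℝ) - 1) with hg
  have hg0 : ∀ t, t ⊆ P' → 0 ≤ g t := fun t ht => Finset.prod_nonneg fun p hp => by
    have : (1 : ℝ) < p := by exact_mod_cast (Finset.mem_filter.1 (ht hp)).2.one_lt
    have : (0 : ℝ) < (p : ℝ) - 1 := by linarith
    positivity
  -- the prime factors of `r ∈ F` lie in `P'`
  have hpfP : ∀ r ∈ F, r.primeFactors ⊆ P' := by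
    intro r hr p hp
    rw [hF, Finset.mem_filter, Finset.mem_Icc] at hr
    rw [hP', Finset.mem_filter, Finset.mem_Ioc]
    have hpp := Nat.prime_of_mem_primeFactors hp
    exact ⟨⟨hr.2.2 p hp, (Nat.le_of_mem_primeFactors hp).trans hr.1.2⟩, hpp⟩
  -- step 1-2: expand and insert the indicator over `U`
  have h12 : ∀ r ∈ F, ∏ p ∈ r.primeFactors, (1 - (p : ℝ)⁻¹)⁻¹ - 1 =
      ∑ t ∈ U, if t ⊆ r.primeFactors then g t else 0 := by
    intro r hr
    rw [prod_one_sub_inv_inv_sub_one_eq, ← Finset.sum_filter]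
    apply Finset.sum_congr ?_ (fun _ _ => rfl)
    ext t
    rw [Finset.mem_erase, Finset.mem_powerset, hU, Finset.mem_filter, Finset.mem_erase, Finset.mem_powerset]
    constructor
    · rintro ⟨h1, h2⟩; exact ⟨⟨h1, h2.trans (hpfP r hr)⟩, h2⟩
    · rintro ⟨⟨h1, -⟩, h2⟩; exact ⟨h1, h2⟩
  -- step 3: swap
  have h3 : ∑ r ∈ F, 1 / (r : ℝ) * (∏ p ∈ r.primeFactors, (1 - (p : ℝ)⁻¹)⁻¹ - 1) =
      ∑ t ∈ U, g t * ∑ r ∈ F, if t ⊆ r.primeFactors then 1 / (r : ℝ) else 0 := by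
    rw [Finset.sum_congr rfl fun r hr => by rw [h12 r hr]]
    simp_rw [Finset.mul_sum]
    rw [Finset.sum_comm]
    refine Finset.sum_congr rfl fun t _ => Finset.sum_congr rfl fun r _ => ?_
    split_ifs <;> ring
  rw [h3]
  -- step 4: the inner sums
  have h4 : ∀ t ∈ U, ∑ r ∈ F, (if t ⊆ r.primeFactors then 1 / (r : ℝ) else 0) ≤
      (1 + Real.log z) / (∏ p ∈ t, (p : ℝ)) := by
    intro t ht
    rw [hU, Finset.mem_erase, Finset.mem_powerset] at ht
    have htprime : ∀ p ∈ t, p.Prime := fun p hp => (Finset.mem_filter.1 (ht.2 hp)).2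
    set d := ∏ p ∈ t, p with hd
    have hd1 : 1 ≤ d := Nat.one_le_iff_ne_zero.2 (Finset.prod_ne_zero_iff.2 fun p hp => (htprime p hp).ne_zero)
    rw [← Finset.sum_filter]
    have hsub : F.filter (fun r => t ⊆ r.primeFactors) ⊆ (Finset.Icc 1 N).filter (fun r => d ∣ r) := by
      intro r hr
      rw [Finset.mem_filter] at hr ⊢
      refine ⟨(Finset.mem_filter.1 hr.1).1, ?_⟩
      exact Finset.prod_primes_dvd r (fun p hp => Nat.prime_iff.1 (htprime p hp))
        fun p hp => Nat.dvd_of_mem_primeFactors (hr.2 hp)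
    calc ∑ r ∈ F.filter (fun r => t ⊆ r.primeFactors), 1 / (r : ℝ)
        ≤ ∑ r ∈ (Finset.Icc 1 N).filter (fun r => d ∣ r), 1 / (r : ℝ) :=
          Finset.sum_le_sum_of_subset_of_nonneg hsub fun r _ _ => by positivity
      _ ≤ (1 + Real.log N) / d := sum_inv_filter_dvd_le hd1 hN1
      _ ≤ (1 + Real.log z) / (∏ p ∈ t, (p : ℝ)) := by
          rw [hd]; push_cast
          refine div_le_div_of_nonneg_right (add_le_add le_rfl (Real.log_le_log (by positivity)
            (Nat.floor_le hz0.le))) (Finset.prod_nonneg fun p _ => by positivity)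
  -- step 5: the sum over `t`
  have h5 : ∑ t ∈ U, g t * ((1 + Real.log z) / ∏ p ∈ t, (p : ℝ)) ≤ (1 + Real.log z) * (2 / w) := by
    have heq : ∑ t ∈ U, g t * ((1 + Real.log z) / ∏ p ∈ t, (p : ℝ)) =
        (1 + Real.log z) * ∑ t ∈ U, ∏ p ∈ t, 1 / ((p : ℝ) * ((p : ℝ) - 1)) := by
      rw [Finset.mul_sum]
      refine Finset.sum_congr rfl fun t ht => ?_
      rw [hg]
      simp only
      rw [mul_div_assoc', mul_comm (∏ p ∈ t, 1 / ((p : ℝ) - 1)), mul_div_assoc, ← Finset.prod_div_distrib]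
      congr 1
      refine Finset.prod_congr rfl fun p _ => ?_
      rw [div_div, mul_comm ((p : ℝ) - 1)]
    rw [heq]
    refine mul_le_mul_of_nonneg_left ?_ (by linarith [Real.log_nonneg hz])
    have hsum : ∑ t ∈ U, ∏ p ∈ t, 1 / ((p : ℝ) * ((p : ℝ) - 1)) =
        ∏ p ∈ P', (1 + 1 / ((p : ℝ) * ((p : ℝ) - 1))) - 1 := by
      rw [Finset.prod_one_add, hU, Finset.sum_erase_eq_sub (Finset.empty_mem_powerset _), Finset.prod_empty]
    rw [hsum]
    have hε : ∀ p ∈ P', 0 ≤ 1 / ((p : ℝ) * ((p : ℝ) - 1)) := fun p hp => by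
      have : (1 : ℝ) < p := by exact_mod_cast (Finset.mem_filter.1 hp).2.one_lt
      have : (0 : ℝ) < (p : ℝ) - 1 := by linarith
      positivity
    have hexp := SquarefreeSums.prod_one_add_le_exp_sum hε
    have hS : ∑ p ∈ P', 1 / ((p : ℝ) * ((p : ℝ) - 1)) ≤ 1 / w :=
      (Finset.sum_le_sum_of_subset_of_nonneg (Finset.filter_subset _ _) fun n hn _ => by
        have : (1 : ℝ) ≤ w := by exact_mod_cast hw
        have : (w : ℝ) < n := by exact_mod_cast (Finset.mem_Ioc.1 hn).1
        have : (0 : ℝ) < (n : ℝ) - 1 := by linarith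
        positivity).trans (sum_Ioc_inv_mul_sub_one_le hw N)
    have hw1 : (1 : ℝ) / w ≤ 1 := by
      rw [div_le_one (by exact_mod_cast hw)]; exact_mod_cast hw
    calc ∏ p ∈ P', (1 + 1 / ((p : ℝ) * ((p : ℝ) - 1))) - 1
        ≤ Real.exp (∑ p ∈ P', 1 / ((p : ℝ) * ((p : ℝ) - 1))) - 1 := by linarith
      _ ≤ Real.exp (1 / w) - 1 := by linarith [Real.exp_le_exp.2 hS]
      _ ≤ 2 * (1 / w) := SquarefreeSums.exp_sub_one_le_two_mul (by positivity) hw1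
      _ = 2 / w := by ring
  calc ∑ t ∈ U, g t * ∑ r ∈ F, (if t ⊆ r.primeFactors then 1 / (r : ℝ) else 0)
      ≤ ∑ t ∈ U, g t * ((1 + Real.log z) / ∏ p ∈ t, (p : ℝ)) := by
        refine Finset.sum_le_sum fun t ht => mul_le_mul_of_nonneg_left (h4 t ht) (hg0 t ?_)
        exact Finset.mem_powerset.1 (Finset.mem_of_mem_erase ht)
    _ ≤ (1 + Real.log z) * (2 / w) := h5
    _ = 2 * (1 + Real.log z) / w := by ring

/-! ### `∑_{r ≤ y, (r,q)=1} μ²(r)/φ(r)` (Goldston–Graham–Pintz–Yıldırım, Lemma 3) -/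

/-- **`G_q(y) = ∑_{r ≤ y, r squarefree, (r,q)=1} 1/φ(r) = (φ(q)/q)(log y + O(1 + ∑_{p∣q} log p/p))`**, uniformly in
`q ≥ 1`, `y ≥ 1`: Goldston–Graham–Pintz–Yıldırım's Lemma 3 (`GGPY.moebiusSqGSum_asymptotic_holds`) for
`γ = 1_{p ∤ q}` (hypotheses `(Ω₁)`, `(Ω₂)` and `c_γ = φ(q)/q` from `MaynardSieveYm.lean`).
[cite: GoldstonEtAl2008, Lemma 3 (κ = 1)] -/
theorem exists_abs_invTotSum_sub_le :
    ∃ C_G : ℝ, 0 ≤ C_G ∧ ∀ (q : ℕ), q ≠ 0 → ∀ y : ℝ, 1 ≤ y →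
      |invTotSum q y - (q.totient : ℝ) / q * Real.log y| ≤
        (q.totient : ℝ) / q * (C_G * (7 + ∑ p ∈ q.primeFactors, Real.log p / p)) := by
  unfold invTotSum
  obtain ⟨C, hC⟩ := GGPY.moebiusSqGSum_asymptotic_holds 2 10 two_pos (by norm_num)
  refine ⟨max C 1, le_max_of_le_right zero_le_one, fun q hq y hy => ?_⟩
  set L := 6 + ∑ p ∈ q.primeFactors, Real.log p / p with hL
  have hS0 : 0 ≤ ∑ p ∈ q.primeFactors, Real.log p / p := Finset.sum_nonneg fun p hp => by
    have : (1 : ℝ) ≤ p := by exact_mod_cast (Nat.prime_of_mem_primeFactors hp).one_lt.le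
    exact div_nonneg (Real.log_nonneg this) (by linarith)
  have hL1 : 1 ≤ L := by rw [hL]; linarith
  obtain ⟨-, hmain⟩ := hC L hL1 (gammaInd q) (hypOmega1_gammaInd q) (hypOmega2_gammaInd hq)
  set n := ⌊y⌋₊ with hn
  have hn1 : 1 ≤ n := Nat.le_floor (by simpa using hy)
  set z : ℝ := ((n + 1 : ℕ) : ℝ) with hz
  have hz2 : (2 : ℝ) ≤ z := by rw [hz]; exact_mod_cast Nat.succ_le_succ hn1
  have h := hmain z hz2
  rw [cGamma_gammaInd hq] at h
  have hφq : 0 < (q.totient : ℝ) / q := div_pos (by exact_mod_cast Nat.totient_pos.2 (Nat.pos_of_ne_zero hq))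
    (by exact_mod_cast Nat.pos_of_ne_zero hq)
  -- our sum is `moebiusSqGSum (gammaInd q) z`
  have hsum : GGPY.moebiusSqGSum (gammaInd q) z =
      ∑ r ∈ (Finset.Icc 1 n).filter (fun r => Squarefree r ∧ r.Coprime q), 1 / (r.totient : ℝ) := by
    unfold GGPY.moebiusSqGSum
    rw [hz, Nat.ceil_natCast, Finset.Ico_add_one_right_eq_Icc, Finset.sum_filter]
    refine Finset.sum_congr rfl fun d hd => ?_
    have hd0 : d ≠ 0 := by have := (Finset.mem_Icc.1 hd).1; omega
    exact moebius_sq_mul_g_gammaInd hd0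
  rw [hsum] at h
  -- `0 ≤ log z - log y ≤ 1`
  have hy0 : 0 < y := by linarith
  have hzy : y < z := by rw [hz]; push_cast; exact Nat.lt_floor_add_one y
  have hzy' : z ≤ y + 1 := by rw [hz]; push_cast; linarith [Nat.floor_le hy0.le]
  have hlog : |Real.log z - Real.log y| ≤ 1 := by
    rw [abs_of_nonneg (by linarith [Real.log_le_log hy0 hzy.le]), ← Real.log_div (by linarith) hy0.ne']
    have h1 : Real.log (z / y) ≤ z / y - 1 := Real.log_le_sub_one_of_pos (by positivity)
    have h2 : z / y - 1 ≤ 1 := by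
      rw [div_sub_one hy0.ne', div_le_one hy0]; linarith
    linarith
  calc |∑ r ∈ (Finset.Icc 1 n).filter (fun r => Squarefree r ∧ r.Coprime q), 1 / (r.totient : ℝ) -
        (q.totient : ℝ) / q * Real.log y|
      = |(∑ r ∈ (Finset.Icc 1 n).filter (fun r => Squarefree r ∧ r.Coprime q), 1 / (r.totient : ℝ) -
          (q.totient : ℝ) / q * Real.log z) + (q.totient : ℝ) / q * (Real.log z - Real.log y)| := by ring_nf
    _ ≤ C * ((q.totient : ℝ) / q) * L + (q.totient : ℝ) / q * 1 := by
        refine (abs_add_le _ _).trans (add_le_add h ?_)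
        rw [abs_mul, abs_of_pos hφq]
        exact mul_le_mul_of_nonneg_left hlog hφq.le
    _ ≤ (q.totient : ℝ) / q * (max C 1 * (7 + ∑ p ∈ q.primeFactors, Real.log p / p)) := by
        have hC1 : C ≤ max C 1 := le_max_left _ _
        have h11 : (1 : ℝ) ≤ max C 1 := le_max_right _ _
        have hm0 : 0 ≤ max C 1 := le_trans zero_le_one h11
        rw [hL]
        nlinarith [mul_nonneg hφq.le hS0, mul_nonneg hφq.le hm0]

/-! ### The evaluation of the pair sum -/

/-- Real-number bookkeeping for one `e`: with `0 ≤ H₁ ≤ P'`, `|g₁ - H₁| ≤ E₁`, `|g₂ - H₂| ≤ E₂`,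
`|g₂| ≤ B P'`, one has `|g₁ g₂ - H₁ H₂| ≤ P' (E₂ + B E₁)`. [folklore] -/
theorem abs_mul_sub_mul_le {g₁ g₂ H₁ H₂ E₁ E₂ P' B : ℝ} (hH₁0 : 0 ≤ H₁) (hH₁ : H₁ ≤ P')
    (hE₁ : |g₁ - H₁| ≤ E₁) (hE₂ : |g₂ - H₂| ≤ E₂) (hg₂ : |g₂| ≤ B * P') :
    |g₁ * g₂ - H₁ * H₂| ≤ P' * (E₂ + B * E₁) := by
  have hP : 0 ≤ P' := hH₁0.trans hH₁
  have hE₁0 : 0 ≤ E₁ := (abs_nonneg _).trans hE₁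
  have heq : g₁ * g₂ - H₁ * H₂ = H₁ * (g₂ - H₂) + (g₁ - H₁) * g₂ := by ring
  rw [heq]
  calc |H₁ * (g₂ - H₂) + (g₁ - H₁) * g₂| ≤ |H₁ * (g₂ - H₂)| + |(g₁ - H₁) * g₂| := abs_add_le _ _
    _ = H₁ * |g₂ - H₂| + |g₁ - H₁| * |g₂| := by rw [abs_mul, abs_mul, abs_of_nonneg hH₁0]
    _ ≤ P' * E₂ + E₁ * (B * P') :=
        add_le_add (mul_le_mul hH₁ hE₂ (abs_nonneg _) hP) (mul_le_mul hE₁ hg₂ (abs_nonneg _) hE₁0)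
    _ = P' * (E₂ + B * E₁) := by ring

/-- Real-number bookkeeping for the main term: `0 ≤ H₁ ≤ H₂`, `H₁ ≤ P'`, `P' - H₁ ≤ D` give
`P'² - 2 P' D ≤ H₁ H₂ ≤ P' H₂`. [folklore] -/
theorem sq_sub_le_mul {H₁ H₂ P' D : ℝ} (hH₁0 : 0 ≤ H₁) (h12 : H₁ ≤ H₂) (hH₁ : H₁ ≤ P') (hD : P' - H₁ ≤ D) :
    P' ^ 2 - 2 * P' * D ≤ H₁ * H₂ := by
  have hD0 : 0 ≤ D := by linarith
  nlinarith [mul_le_mul h12 le_rfl hH₁0 (hH₁0.trans h12), sq_nonneg (P' - H₁)]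

/-- `∏_{p ∣ r} (1 - 1/p)⁻¹ ≥ 1`. [folklore] -/
theorem one_le_prod_one_sub_inv_inv (r : ℕ) : 1 ≤ ∏ p ∈ r.primeFactors, (1 - (p : ℝ)⁻¹)⁻¹ := by
  have h := prod_one_sub_inv_inv_sub_one_eq r
  have h0 : 0 ≤ ∑ t ∈ r.primeFactors.powerset.erase ∅, ∏ p ∈ t, 1 / ((p : ℝ) - 1) :=
    Finset.sum_nonneg fun t ht => Finset.prod_nonneg fun p hp => by
      have htsub := Finset.mem_powerset.1 (Finset.mem_of_mem_erase ht)
      have : (1 : ℝ) < p := by exact_mod_cast (Nat.prime_of_mem_primeFactors (htsub hp)).one_lt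
      have : (0 : ℝ) < (p : ℝ) - 1 := by linarith
      positivity
  linarith

/-! ### The evaluation of `S₁(q; R₁, R₂)` -/

set_option maxHeartbeats 800000 in -- one long assembly carrying ~30 local estimates; 4× the default budget
/-- **Uniform two-level evaluation of the sifted one-form sum.** There is an absolute constant `K`
such that for every `q ≥ 1` divisible by all primes `p ≤ w` (`w ≥ 1`) and all `1 ≤ R₁ ≤ R₂`, with
`P = q/φ(q)`,
`|S₁(q; R₁, R₂) - P log R₁| ≤ P (K (1 + ∑_{p ∣ q} log p/p + Π_q(1/2)) + 4 P (1 + log R₁)/w)`.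
(On the elementary route this replaces the contour-integral evaluation
`(2πi)⁻² ∫∫ ζ(1+z+z')/(ζ(1+z)ζ(1+z')) R₁^z R₂^{z'} dz dz'/(z²z'²)` of Green–Tao's Lemma A.3; by
`SharpGY.diagSum` symmetry the case `R₂ ≤ R₁` follows with `log R₂`.)
[cite: GreenTaoAnnals2008, Appendix A Lemma A.3 (elementary substitute)] -/
theorem exists_diagSum_bound :
    ∃ K : ℝ, 0 ≤ K ∧ ∀ (q w : ℕ), q ≠ 0 → 1 ≤ w → (∀ p : ℕ, p.Prime → p ≤ w → p ∣ q) →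
      ∀ R₁ R₂ : ℝ, 1 ≤ R₁ → R₁ ≤ R₂ →
        |diagSum q R₁ R₂ - (q : ℝ) / q.totient * Real.log R₁| ≤
          (q : ℝ) / q.totient * ((K * (1 + ∑ p ∈ q.primeFactors, Real.log p / p + rankinProd (1 / 2) q)) +
            4 * ((q : ℝ) / q.totient) * (1 + Real.log R₁) / w) := by
  obtain ⟨c, hc, C, hC0, hg⟩ := exists_abs_moebLog_sub_one_le_all
  obtain ⟨B, hB1, hB⟩ := exists_moebLog_bound
  obtain ⟨C_G, hCG0, hG⟩ := exists_abs_invTotSum_sub_le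
  have hB0 : 0 ≤ B := le_trans zero_le_one hB1
  set K₀ : ℝ := 3 * (C * (1 + 48 / c ^ 4)) with hK₀
  have hK₀0 : 0 ≤ K₀ := by positivity
  refine ⟨(1 + B) * K₀ + 7 * C_G + 8, by positivity, fun q w hq hw hqw R₁ R₂ hR₁ h12 => ?_⟩
  -- notation and basic positivity
  set P : ℝ := (q : ℝ) / q.totient with hP
  have hφq0 : (0 : ℝ) < q.totient := by exact_mod_cast Nat.totient_pos.2 (Nat.pos_of_ne_zero hq)
  have hq0 : (0 : ℝ) < q := by exact_mod_cast Nat.pos_of_ne_zero hq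
  have hP0 : 0 < P := div_pos hq0 hφq0
  have hR₁0 : 0 < R₁ := by linarith
  set F := (Finset.Icc 1 ⌊R₁⌋₊).filter (fun r => Squarefree r ∧ r.Coprime q) with hF
  set Pq : ℝ := rankinProd (1 / 2) q with hPq
  have hPq1 : 1 ≤ Pq := one_le_rankinProd (by norm_num) q
  set Lq : ℝ := ∑ p ∈ q.primeFactors, Real.log p / p with hLq
  obtain ⟨hδ0, hδanti⟩ := antitoneOn_expDecay hc.le hC0
  set Et : ℝ → ℕ → ℝ := fun y r =>
    ∑ t ∈ (Finset.Icc 1 ⌊y / r⌋₊).filter (fun t : ℕ => t.primeFactors ⊆ (q * r).primeFactors),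
      1 / (t : ℝ) * (C * Real.exp (-(c * Real.sqrt (Real.log (y / r / t))))) with hEt
  -- membership facts
  have hmem : ∀ r ∈ F, 1 ≤ r ∧ (r : ℝ) ≤ R₁ ∧ Squarefree r ∧ r.Coprime q := by
    intro r hr
    rw [hF, Finset.mem_filter, Finset.mem_Icc] at hr
    exact ⟨hr.1.1, le_trans (by exact_mod_cast hr.1.2) (Nat.floor_le hR₁0.le), hr.2.1, hr.2.2⟩
  have hPr : ∀ r ∈ F, ((q * r : ℕ) : ℝ) / ((q * r).totient : ℝ) = P * ((r : ℝ) / r.totient) := by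
    intro r hr
    rw [hP]
    exact div_totient_mul (hmem r hr).2.2.2.symm
  -- (E): the error sums
  have hE : ∀ y : ℝ, R₁ ≤ y → ∑ r ∈ F, 1 / (r : ℝ) * Et y r ≤ K₀ := by
    intro y hy
    have hy1 : 1 ≤ y := hR₁.trans hy
    have hsub : F ⊆ (Finset.Icc 1 ⌊y⌋₊).filter (fun r => Squarefree r ∧ r.Coprime q) := by
      intro r hr
      rw [hF, Finset.mem_filter, Finset.mem_Icc] at hr
      rw [Finset.mem_filter, Finset.mem_Icc]
      exact ⟨⟨hr.1.1, hr.1.2.trans (Nat.floor_le_floor hy)⟩, hr.2⟩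
    have hnn : ∀ r ∈ (Finset.Icc 1 ⌊y⌋₊).filter (fun r => Squarefree r ∧ r.Coprime q), r ∉ F →
        0 ≤ 1 / (r : ℝ) * Et y r := fun r _ _ =>
      mul_nonneg (by positivity) (Finset.sum_nonneg fun t _ => mul_nonneg (by positivity) (by positivity))
    calc ∑ r ∈ F, 1 / (r : ℝ) * Et y r
        ≤ ∑ r ∈ (Finset.Icc 1 ⌊y⌋₊).filter (fun r => Squarefree r ∧ r.Coprime q), 1 / (r : ℝ) * Et y r :=
          Finset.sum_le_sum_of_subset_of_nonneg hsub hnn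
      _ ≤ 3 * ∑ k ∈ Finset.range (⌊Real.log y⌋₊ + 1), C * Real.exp (-(c * Real.sqrt (Real.log (Real.exp k)))) :=
          sum_inv_mul_friableErr_le hδ0 hδanti hq hy1
      _ ≤ K₀ := by
          rw [hK₀]; exact mul_le_mul_of_nonneg_left (sum_expDecay_exp_le hc hC0 _) (by norm_num)
  -- (T): the excess
  have hT : ∑ r ∈ F, 1 / (r : ℝ) * ((r : ℝ) / r.totient - 1) ≤ 2 * (1 + Real.log R₁) / w := by
    have hsub : F ⊆ (Finset.Icc 1 ⌊R₁⌋₊).filter (fun r => Squarefree r ∧ ∀ p ∈ r.primeFactors, w < p) := by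
      intro r hr
      have hr' := hr
      rw [hF, Finset.mem_filter] at hr'
      rw [Finset.mem_filter]
      refine ⟨hr'.1, hr'.2.1, fun p hp => ?_⟩
      by_contra hle
      push Not at hle
      have hpp := Nat.prime_of_mem_primeFactors hp
      have hpq : p ∣ q := hqw p hpp hle
      have hpr : p ∣ r := Nat.dvd_of_mem_primeFactors hp
      exact (Nat.Prime.coprime_iff_not_dvd hpp).1 (hr'.2.2.coprime_dvd_left hpr) hpq
    have heq : ∀ r ∈ F, 1 / (r : ℝ) * ((r : ℝ) / r.totient - 1) =
        1 / (r : ℝ) * (∏ p ∈ r.primeFactors, (1 - (p : ℝ)⁻¹)⁻¹ - 1) := by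
      intro r hr
      rw [div_totient_eq_prod_inv (by have := (hmem r hr).1; omega)]
    rw [Finset.sum_congr rfl heq]
    refine le_trans (Finset.sum_le_sum_of_subset_of_nonneg hsub fun r _ _ => ?_) (sum_inv_mul_excess_le hw hR₁)
    exact mul_nonneg (by positivity) (by linarith [one_le_prod_one_sub_inv_inv r])
  -- (S): the Rankin tails
  have hS : ∑ r ∈ F, 1 / (r : ℝ) * (R₁ / r) ^ (-(1 / 2 : ℝ)) ≤ 2 := by
    have heq : ∀ r ∈ F, 1 / (r : ℝ) * (R₁ / r) ^ (-(1 / 2 : ℝ)) = R₁ ^ (-(1 / 2 : ℝ)) * (r : ℝ) ^ (-(1 / 2 : ℝ)) := by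
      intro r hr
      have hr0 : (0 : ℝ) < r := by exact_mod_cast (hmem r hr).1
      have hA : (R₁ / r) ^ (-(1 / 2 : ℝ)) = R₁ ^ (-(1 / 2 : ℝ)) * (r : ℝ) ^ (1 / 2 : ℝ) := by
        rw [Real.div_rpow hR₁0.le hr0.le, Real.rpow_neg hr0.le, div_inv_eq_mul]
      have hB' : 1 / (r : ℝ) * (r : ℝ) ^ (1 / 2 : ℝ) = (r : ℝ) ^ (-(1 / 2 : ℝ)) := by
        rw [one_div, ← Real.rpow_neg_one, ← Real.rpow_add hr0]; norm_num
      rw [hA, mul_left_comm, hB']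
    rw [Finset.sum_congr rfl heq, ← Finset.mul_sum]
    have hsub : F ⊆ Finset.Icc 1 ⌊R₁⌋₊ := Finset.filter_subset _ _
    have h1 : ∑ r ∈ F, (r : ℝ) ^ (-(1 / 2 : ℝ)) ≤ 2 * Real.sqrt ⌊R₁⌋₊ :=
      (Finset.sum_le_sum_of_subset_of_nonneg hsub fun r _ _ => by positivity).trans (LFunctions.AFE.sum_Icc_rpow_neg_half_le _)
    have h2 : Real.sqrt ⌊R₁⌋₊ ≤ R₁ ^ (1 / 2 : ℝ) := by
      rw [Real.sqrt_eq_rpow]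
      exact Real.rpow_le_rpow (by positivity) (Nat.floor_le hR₁0.le) (by norm_num)
    have h3 : R₁ ^ (-(1 / 2 : ℝ)) * R₁ ^ (1 / 2 : ℝ) = 1 := by
      rw [← Real.rpow_add hR₁0]; norm_num
    calc R₁ ^ (-(1 / 2 : ℝ)) * ∑ r ∈ F, (r : ℝ) ^ (-(1 / 2 : ℝ))
        ≤ R₁ ^ (-(1 / 2 : ℝ)) * (2 * R₁ ^ (1 / 2 : ℝ)) :=
          mul_le_mul_of_nonneg_left (h1.trans (by linarith)) (by positivity)
      _ = 2 := by linear_combination 2 * h3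
  -- (G): the main term
  have hGsum : |P * ∑ r ∈ F, 1 / (r.totient : ℝ) - Real.log R₁| ≤ C_G * (7 + Lq) := by
    have h := hG q hq R₁ hR₁
    have hinv : invTotSum q R₁ = ∑ r ∈ F, 1 / (r.totient : ℝ) := rfl
    rw [hinv] at h
    have hφP : (q.totient : ℝ) / q = P⁻¹ := by rw [hP, inv_div]
    rw [hφP] at h
    have h2 : P * ∑ r ∈ F, 1 / (r.totient : ℝ) - Real.log R₁ =
        P * (∑ r ∈ F, 1 / (r.totient : ℝ) - P⁻¹ * Real.log R₁) := by field_simp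
    rw [h2, abs_mul, abs_of_pos hP0]
    calc P * |∑ r ∈ F, 1 / (r.totient : ℝ) - P⁻¹ * Real.log R₁| ≤ P * (P⁻¹ * (C_G * (7 + Lq))) :=
          mul_le_mul_of_nonneg_left h hP0.le
      _ = C_G * (7 + Lq) := by field_simp
  -- the per-`r` bound
  have hper : ∀ r ∈ F,
      |(r.totient : ℝ) / (r : ℝ) ^ 2 * (moebLogCop (q * r) (R₁ / r) * moebLogCop (q * r) (R₂ / r)) -
          P ^ 2 * (1 / (r.totient : ℝ))| ≤
        P / r * (Et R₂ r + B * Et R₁ r +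
          2 * (((r : ℝ) / r.totient - 1) * P + 2 * (R₁ / r) ^ (-(1 / 2 : ℝ)) * Pq)) := by
    intro r hr
    obtain ⟨hr1, hrR, hsq, hco⟩ := hmem r hr
    have hr0 : (0 : ℝ) < r := by exact_mod_cast hr1
    have hφr0 : (0 : ℝ) < r.totient := by exact_mod_cast Nat.totient_pos.2 hr1
    have hqr : q * r ≠ 0 := Nat.mul_ne_zero hq (by omega)
    set ρ : ℝ := (r : ℝ) / r.totient with hρ
    set Pr : ℝ := P * ρ with hPr'
    have hPr_eq : ((q * r : ℕ) : ℝ) / ((q * r).totient : ℝ) = Pr := hPr r hr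
    set H₁ := ∑ t ∈ (Finset.Icc 1 ⌊R₁ / r⌋₊).filter (fun t : ℕ => t.primeFactors ⊆ (q * r).primeFactors),
      (1 : ℝ) / t with hH₁
    set H₂ := ∑ t ∈ (Finset.Icc 1 ⌊R₂ / r⌋₊).filter (fun t : ℕ => t.primeFactors ⊆ (q * r).primeFactors),
      (1 : ℝ) / t with hH₂
    set g₁ := moebLogCop (q * r) (R₁ / r) with hg₁
    set g₂ := moebLogCop (q * r) (R₂ / r) with hg₂
    have hv1 : 1 ≤ R₁ / r := by rw [le_div_iff₀ hr0, one_mul]; exact hrR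
    have hv12 : R₁ / r ≤ R₂ / r := div_le_div_of_nonneg_right h12 hr0.le
    have hH₁0 : 0 ≤ H₁ := friable_nonneg _ _
    have hH12 : H₁ ≤ H₂ := friable_mono _ hv12
    have hH₁P : H₁ ≤ Pr := by rw [← hPr_eq]; exact sum_radInd_div_le hqr _
    have hH₂P : H₂ ≤ Pr := by rw [← hPr_eq]; exact sum_radInd_div_le hqr _
    have hE₁ : |g₁ - H₁| ≤ Et R₁ r := abs_moebLogCop_sub_sum_le hg hqr _
    have hE₂ : |g₂ - H₂| ≤ Et R₂ r := abs_moebLogCop_sub_sum_le hg hqr _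
    have hg₂b : |g₂| ≤ B * Pr := by rw [← hPr_eq]; exact abs_moebLogCop_le hB hqr _
    -- the deficiency `Pr - H₁`
    set D : ℝ := (ρ - 1) * P + 2 * (R₁ / r) ^ (-(1 / 2 : ℝ)) * Pq with hD
    have hDb : Pr - H₁ ≤ D := by
      have hmono : ∑ t ∈ (Finset.Icc 1 ⌊R₁ / r⌋₊).filter (fun t : ℕ => t.primeFactors ⊆ q.primeFactors),
          (1 : ℝ) / t ≤ H₁ :=
        friable_mono_left (Nat.primeFactors_mono (Dvd.intro r rfl) hqr) _
      have htail := div_totient_sub_friable_le hq hv1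
      rw [hD, hPr']
      have : P - ∑ t ∈ (Finset.Icc 1 ⌊R₁ / r⌋₊).filter (fun t : ℕ => t.primeFactors ⊆ q.primeFactors),
          (1 : ℝ) / t ≤ 2 * (R₁ / r) ^ (-(1 / 2 : ℝ)) * Pq := by rw [hP, hPq]; exact htail
      nlinarith
    have hlow := sq_sub_le_mul hH₁0 hH12 hH₁P hDb
    have hPr0 : 0 ≤ Pr := hH₁0.trans hH₁P
    have hup : H₁ * H₂ ≤ Pr ^ 2 := by nlinarith [mul_le_mul hH₁P hH₂P (hH₁0.trans hH12) hPr0]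
    have hD0 : 0 ≤ D := by linarith
    have hcross := abs_mul_sub_mul_le hH₁0 hH₁P hE₁ hE₂ hg₂b
    have hmain : |g₁ * g₂ - Pr ^ 2| ≤ Pr * (Et R₂ r + B * Et R₁ r) + 2 * Pr * D := by
      have h1 : |H₁ * H₂ - Pr ^ 2| ≤ 2 * Pr * D := by
        rw [abs_sub_le_iff]; constructor <;> nlinarith
      calc |g₁ * g₂ - Pr ^ 2| = |(g₁ * g₂ - H₁ * H₂) + (H₁ * H₂ - Pr ^ 2)| := by ring_nf
        _ ≤ |g₁ * g₂ - H₁ * H₂| + |H₁ * H₂ - Pr ^ 2| := abs_add_le _ _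
        _ ≤ _ := add_le_add hcross h1
    -- multiply by `φ(r)/r²`
    have hcoef : (r.totient : ℝ) / (r : ℝ) ^ 2 * Pr = P / r := by
      rw [hPr', hρ]; field_simp
    have hcoef2 : (r.totient : ℝ) / (r : ℝ) ^ 2 * Pr ^ 2 = P ^ 2 * (1 / (r.totient : ℝ)) := by
      rw [hPr', hρ]; field_simp
    have hcoef0 : 0 ≤ (r.totient : ℝ) / (r : ℝ) ^ 2 := by positivity
    rw [← hcoef2, ← mul_sub, abs_mul, abs_of_nonneg hcoef0]
    calc (r.totient : ℝ) / (r : ℝ) ^ 2 * |g₁ * g₂ - Pr ^ 2|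
        ≤ (r.totient : ℝ) / (r : ℝ) ^ 2 * (Pr * (Et R₂ r + B * Et R₁ r) + 2 * Pr * D) :=
          mul_le_mul_of_nonneg_left hmain hcoef0
      _ = P / r * (Et R₂ r + B * Et R₁ r + 2 * D) := by
          rw [← hcoef]; ring
  -- summing the per-`r` bounds
  have hsumF : |∑ r ∈ F, (r.totient : ℝ) / (r : ℝ) ^ 2 *
        (moebLogCop (q * r) (R₁ / r) * moebLogCop (q * r) (R₂ / r)) - P ^ 2 * ∑ r ∈ F, 1 / (r.totient : ℝ)| ≤
      (1 + B) * P * K₀ + 4 * P ^ 2 * (1 + Real.log R₁) / w + 8 * P * Pq := by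
    rw [Finset.mul_sum, ← Finset.sum_sub_distrib]
    refine (Finset.abs_sum_le_sum_abs _ _).trans ?_
    refine (Finset.sum_le_sum hper).trans ?_
    have hsplit : ∑ r ∈ F, P / r * (Et R₂ r + B * Et R₁ r +
        2 * (((r : ℝ) / r.totient - 1) * P + 2 * (R₁ / r) ^ (-(1 / 2 : ℝ)) * Pq)) =
        P * ∑ r ∈ F, 1 / (r : ℝ) * Et R₂ r + B * P * ∑ r ∈ F, 1 / (r : ℝ) * Et R₁ r +
          2 * P ^ 2 * ∑ r ∈ F, 1 / (r : ℝ) * ((r : ℝ) / r.totient - 1) +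
          4 * P * Pq * ∑ r ∈ F, 1 / (r : ℝ) * (R₁ / r) ^ (-(1 / 2 : ℝ)) := by
      have hterm : ∀ r ∈ F, P / r * (Et R₂ r + B * Et R₁ r +
          2 * (((r : ℝ) / r.totient - 1) * P + 2 * (R₁ / r) ^ (-(1 / 2 : ℝ)) * Pq)) =
          P * (1 / (r : ℝ) * Et R₂ r) + B * P * (1 / (r : ℝ) * Et R₁ r) +
            2 * P ^ 2 * (1 / (r : ℝ) * ((r : ℝ) / r.totient - 1)) +
            4 * P * Pq * (1 / (r : ℝ) * (R₁ / r) ^ (-(1 / 2 : ℝ))) := fun r _ => by ring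
      rw [Finset.sum_congr rfl hterm, Finset.sum_add_distrib, Finset.sum_add_distrib, Finset.sum_add_distrib,
        ← Finset.mul_sum, ← Finset.mul_sum, ← Finset.mul_sum, ← Finset.mul_sum]
    rw [hsplit]
    have h1 := hE R₂ h12
    have h2 := hE R₁ le_rfl
    have hw0 : (0 : ℝ) < w := by exact_mod_cast hw
    have h3 : 2 * P ^ 2 * ∑ r ∈ F, 1 / (r : ℝ) * ((r : ℝ) / r.totient - 1) ≤ 4 * P ^ 2 * (1 + Real.log R₁) / w := by
      have := mul_le_mul_of_nonneg_left hT (by positivity : (0 : ℝ) ≤ 2 * P ^ 2)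
      refine this.trans (le_of_eq ?_); ring
    have h4 : 4 * P * Pq * ∑ r ∈ F, 1 / (r : ℝ) * (R₁ / r) ^ (-(1 / 2 : ℝ)) ≤ 8 * P * Pq := by
      have := mul_le_mul_of_nonneg_left hS (by positivity : (0 : ℝ) ≤ 4 * P * Pq)
      linarith
    have h5 : P * ∑ r ∈ F, 1 / (r : ℝ) * Et R₂ r ≤ P * K₀ := mul_le_mul_of_nonneg_left h1 hP0.le
    have h6 : B * P * ∑ r ∈ F, 1 / (r : ℝ) * Et R₁ r ≤ B * P * K₀ :=
      mul_le_mul_of_nonneg_left h2 (by positivity)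
    linarith
  -- conclusion
  have hdiag : diagSum q R₁ R₂ = ∑ r ∈ F, (r.totient : ℝ) / (r : ℝ) ^ 2 *
      (moebLogCop (q * r) (R₁ / r) * moebLogCop (q * r) (R₂ / r)) := by
    rw [diagSum_eq hq]
    exact Finset.sum_congr rfl fun r _ => by ring
  rw [hdiag]
  have hfin : |∑ r ∈ F, (r.totient : ℝ) / (r : ℝ) ^ 2 *
        (moebLogCop (q * r) (R₁ / r) * moebLogCop (q * r) (R₂ / r)) - P * Real.log R₁| ≤
      (1 + B) * P * K₀ + 4 * P ^ 2 * (1 + Real.log R₁) / w + 8 * P * Pq + P * (C_G * (7 + Lq)) := by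
    have htri := abs_sub_le (∑ r ∈ F, (r.totient : ℝ) / (r : ℝ) ^ 2 *
        (moebLogCop (q * r) (R₁ / r) * moebLogCop (q * r) (R₂ / r)))
      (P ^ 2 * ∑ r ∈ F, 1 / (r.totient : ℝ)) (P * Real.log R₁)
    have h2 : |P ^ 2 * ∑ r ∈ F, 1 / (r.totient : ℝ) - P * Real.log R₁| ≤ P * (C_G * (7 + Lq)) := by
      have : P ^ 2 * ∑ r ∈ F, 1 / (r.totient : ℝ) - P * Real.log R₁ =
          P * (P * ∑ r ∈ F, 1 / (r.totient : ℝ) - Real.log R₁) := by ring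
      rw [this, abs_mul, abs_of_pos hP0]
      exact mul_le_mul_of_nonneg_left hGsum hP0.le
    linarith
  refine hfin.trans (le_of_sub_nonneg ?_)
  have hLq0 : 0 ≤ Lq := Finset.sum_nonneg fun p hp => by
    have : (1 : ℝ) ≤ p := by exact_mod_cast (Nat.prime_of_mem_primeFactors hp).one_lt.le
    exact div_nonneg (Real.log_nonneg this) (by linarith)
  have hlog0 : 0 ≤ Real.log R₁ := Real.log_nonneg hR₁
  have hw0 : (0 : ℝ) < w := by exact_mod_cast hw
  have key : P * ((((1 + B) * K₀ + 7 * C_G + 8) * (1 + Lq + Pq))) + 4 * P * (1 + Real.log R₁) / w * P -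
      ((1 + B) * P * K₀ + 4 * P ^ 2 * (1 + Real.log R₁) / w + 8 * P * Pq + P * (C_G * (7 + Lq))) =
      P * ((1 + B) * K₀ * (Lq + Pq) + 7 * C_G * Pq + 6 * C_G * Lq + 8 * (Lq + 1)) := by ring
  have hrhs : (q : ℝ) / q.totient * ((((1 + B) * K₀ + 7 * C_G + 8) * (1 + ∑ p ∈ q.primeFactors, Real.log p / p +
      rankinProd (1 / 2) q)) + 4 * ((q : ℝ) / q.totient) * (1 + Real.log R₁) / w) =
      P * ((((1 + B) * K₀ + 7 * C_G + 8) * (1 + Lq + Pq))) + 4 * P * (1 + Real.log R₁) / w * P := by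
    rw [hP, hLq, hPq]; ring
  rw [hrhs, key]
  have hPq0 : 0 ≤ Pq := by linarith
  positivity

end GYCorr

end Literature.NumberTheory.Sieve.GreenTao2008
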